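import Summits.QuantumFields.YangMills.Theorems.BalabanLadderUVOtherGroupsDefs
import Summits.QuantumFields.YangMills.Theorems.BalabanLadderUVOtherGroupsSUN
import Summits.QuantumFields.YangMills.Theorems.BalabanLadderUVSeamRecCeilingsTransfer
import HarnessLib

/-!
# Route `BalabanLadder`, crux `UVOtherGroups` (stmt-QuantumFields-19356): banking in WITNESS currency for the `SU(N)` class

Helper file (`--supports stmt-QuantumFields-19356`, fleet seat `ym-osasm-p2`).  The route owner's ruling of 2026-08-26T16:00:55Z (ym-beyond-p2
g20, on this seat's `FINDING-19356-SUN-split.md` §3) ADOPTS the witness shape for the `SU(N)` class: at the next route edit the residual leg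
`UVOtherGroups` is replaced by `UVApexSUN := ∀ N ≥ 3, UVD59 N` · `UVSeamWitnessSUN` (verbatim `Theorems/BalabanLadderUVOtherGroupsDefs.lean`
§3) · `UVNonSUN`, and `closes` becomes three-branched with the body of `UVOtherGroups.yangMills_of_witnessSplit`.  Until then «everything
provable in witness currency is bankable as `--supports stmt-QuantumFields-19356`».  This file is the COMPOSITION LAYER of the witness
item, the `SU(N)` twin of the `UVSeamRec` skeleton's `UVSeamRec_of` (v4-F): the witness `∃ r a, floors ∧ ceilings` is assembled from
its two honest parts — (E0′) ceilings for ONE representation `r` at SOME positive unit `u` (UV-consuming; intended `r` = the fundamental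
representation of Bałaban's Wilson action, `u` = Bałaban's own unit) and (NT-engine) floors for the same `r` at a positive unit `a → 0`
that is eventually COARSER than `u` up to a constant — by the landed ONE-SIDED ceilings transfer
`UVSeamRec.CeilingsTransfer.momentBounds6_of_eventually_le` (ceilings move to any eventually coarser unit).  One-sided comparability
`u ≤ c · a` suffices here (the witness keeps the floors' unit), whereas the `SU(2)` line of record moves the FLOORS to the pinned unit of
record and needs ratio convergence (`UnitTransfer.lowerBounds_of_tendsto_div_of_momentBounds6`).

* `legsWitness_of_floors_of_ceilings_le` — floors at `a`, ceilings at `u`, `u ≤ c · a` eventually ⇒ the legs witness at `(r, a)`;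
* `legsWitness_of_floors_of_ceilings_tendsto_div` — the same fed by ratio convergence `a / u → c₀ > 0`;
* `uvSeamWitnessSUN_of_parts` — `UVSeamWitnessSUN` from its two parts per `N ≥ 3`.

HONEST FRAMING: composition only; both parts (E0′ per `SU(N)`, announced [B16] p. 356 and never printed; the non-triviality engine per
`SU(N)`, dimensional transmutation) are OPEN and are hypotheses here; nothing is discharged.  Not a gap, not Clay.
-/

set_option autoImplicit false

noncomputable section

open MeasureTheory Filter Topology
open Literature.MathematicalPhysics.QuantumFieldTheory
open Summit.QuantumFields.YangMills.Cruxes.OSLegsFromFemtoAndGap.DlrCollarTransfer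

namespace Summit.QuantumFields.YangMills.Theorems.UVOtherGroups

section WitnessParts

variable {G : Type} [Group G] [TopologicalSpace G] [IsTopologicalGroup G] [CompactSpace G]
  [MeasurableSpace G] [BorelSpace G]

/-- **Legs witness from floors and eventually-finer ceilings**: floors `LowerBounds G r a` at a positive unit `a → 0`, ceilings
`MomentBounds6 G r u` at a unit `u` with `u ≤ c · a` eventually (`c > 0`) ⇒ the witness `(r, a)` carries floors ∧ ceilings
(the ceilings move down to `a` by `momentBounds6_of_eventually_le`). -/
theorem legsWitness_of_floors_of_ceilings_le (r : LatticeRep G) {a u : ℝ → ℝ} {c : ℝ} (ha : ∀ β, 0 < a β)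
    (ha0 : Tendsto a atTop (𝓝 0)) (hLB : LowerBounds G r a) (hMB : MomentBounds6 G r u) (hc : 0 < c)
    (hle : ∀ᶠ β in atTop, u β ≤ c * a β) :
    ∃ (r : LatticeRep G) (a : ℝ → ℝ), (∀ β, 0 < a β) ∧ Tendsto a atTop (𝓝 0) ∧ LowerBounds G r a ∧ MomentBounds6 G r a :=
  ⟨r, a, ha, ha0, hLB, Summit.QuantumFields.YangMills.Cruxes.UVSeamRec.CeilingsTransfer.momentBounds6_of_eventually_le r hc hle hMB⟩

/-- **Legs witness from floors and commensurable ceilings** (ratio form): floors at a positive unit `a → 0`, ceilings at a positive unit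
`u` with `a β / u β → c₀ > 0` ⇒ the witness `(r, a)` (eventually `u ≤ (2/c₀) · a`). -/
theorem legsWitness_of_floors_of_ceilings_tendsto_div (r : LatticeRep G) {a u : ℝ → ℝ} {c₀ : ℝ} (ha : ∀ β, 0 < a β)
    (ha0 : Tendsto a atTop (𝓝 0)) (hu : ∀ β, 0 < u β) (hc₀ : 0 < c₀)
    (hau : Tendsto (fun β => a β / u β) atTop (𝓝 c₀)) (hLB : LowerBounds G r a) (hMB : MomentBounds6 G r u) :
    ∃ (r : LatticeRep G) (a : ℝ → ℝ), (∀ β, 0 < a β) ∧ Tendsto a atTop (𝓝 0) ∧ LowerBounds G r a ∧ MomentBounds6 G r a := by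
  refine legsWitness_of_floors_of_ceilings_le r ha ha0 hLB hMB (c := 2 / c₀) (by positivity) ?_
  filter_upwards [hau.eventually_const_le (half_lt_self hc₀)] with β hβ
  have h1 : c₀ / 2 * u β ≤ a β := (le_div_iff₀ (hu β)).1 hβ
  have h2 : (2 / c₀) * (c₀ / 2) = 1 := by field_simp
  calc u β = (2 / c₀) * (c₀ / 2 * u β) := by rw [← mul_assoc, h2, one_mul]
    _ ≤ (2 / c₀) * a β := mul_le_mul_of_nonneg_left h1 (by positivity)

end WitnessParts

/-- **`UVSeamWitnessSUN` from its two parts, per `N ≥ 3`** — the composition theorem of the adopted witness item (the `SU(N)` twin of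
`UVSeamRec_of`): IF for every `N ≥ 3` the apex package at `SU(N)` yields ONE lattice representation `r` of `SU(N)` (intended: the
fundamental one) with (E0′) ceilings `MomentBounds6 SU(N) r u` at some unit `u` and (NT-engine) floors `LowerBounds SU(N) r a` at a positive
unit `a → 0` eventually coarser than `u` (`u ≤ c · a`, `c > 0`), THEN `UVSeamWitnessSUN` (witness `(r, a)`). -/
theorem uvSeamWitnessSUN_of_parts
    (h : ∀ (N : ℕ) [NeZero N], 3 ≤ N → YMDAG.UVSplit.UVD59 N →
      ∃ (r : LatticeRep (Matrix.specialUnitaryGroup (Fin N) ℂ)) (u a : ℝ → ℝ) (c : ℝ),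
        MomentBounds6 (Matrix.specialUnitaryGroup (Fin N) ℂ) r u ∧ (∀ β, 0 < a β) ∧ Tendsto a atTop (𝓝 0) ∧
        LowerBounds (Matrix.specialUnitaryGroup (Fin N) ℂ) r a ∧ 0 < c ∧ ∀ᶠ β in atTop, u β ≤ c * a β) :
    UVSeamWitnessSUN := by
  intro N _ hN hD
  obtain ⟨r, u, a, c, hMB, ha, ha0, hLB, hc, hle⟩ := h N hN hD
  exact legsWitness_of_floors_of_ceilings_le r ha ha0 hLB hMB hc hle

/-! ## The all-record glue (appended 2026-08-26, after director-ym 16:41:17Z: owner ruling (B) stands AND the other-groups census'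
record form (b) is input to the non-`SU(N)` piece — «reconcile both in the ONE edit»)

The deciding-theorem body for the reconciled edit, NT-free, seven binders: `SU(2)` class by `UV` + `UVSeamRec` at the unit of record;
`SU(N ≥ 3)` class by `UVApexSUN := ∀ N ≥ 3, UVD59 N` + `UVSeamWitnessSUN` transported along the isomorphism; every other compact simple `G`
by a RECORD-form residual (∃ `(r, a)` carrying floors ∧ ceilings; stated inline below — the decl name is the owner's to choose); then
`IR` and `ROT` at the witness.  `NT` is consumed in no branch.  Kernel-checked here so the edit's `closes` is a transcription. -/

/-- **`YangMills` from the reconciled all-record split** (bridge `Y2Bridge.yangMills_of_legs`): `UV → UVSeamRec → (∀ N ≥ 3, UVD59 N) →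
UVSeamWitnessSUN → ⟨non-SU(N) residual in record form⟩ → IR → ROT → YangMills`.  Conditional on all seven hypotheses; nothing is
discharged; not a route (the spine's `closes` is unchanged until the owner's edit). -/
theorem yangMills_of_recordSplit (hUV : Summit.QuantumFields.YangMills.Theses.BalabanLadder.UV)
    (hSeamRec : Summit.QuantumFields.YangMills.Theses.BalabanLadder.UVSeamRec)
    (hApexSUN : ∀ (N : ℕ) [NeZero N], 3 ≤ N → YMDAG.UVSplit.UVD59 N) (hWit : UVSeamWitnessSUN)
    (hNonRec : ∀ (G : Type) [Group G] [TopologicalSpace G] [IsTopologicalGroup G] [CompactSpace G],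
      IsCompactSimpleLieGroup G → (∀ N : ℕ, 2 ≤ N → IsEmpty (G ≃ₜ* Matrix.specialUnitaryGroup (Fin N) ℂ)) →
      letI : MeasurableSpace G := borel G; haveI : BorelSpace G := ⟨rfl⟩;
      ∃ (r : LatticeRep G) (a : ℝ → ℝ), (∀ β, 0 < a β) ∧ Tendsto a atTop (𝓝 0) ∧ LowerBounds G r a ∧ MomentBounds6 G r a)
    (hIR : Summit.QuantumFields.YangMills.Theses.BalabanLadder.IR) (hROT : Summit.QuantumFields.YangMills.Theses.BalabanLadder.ROT) :
    YangMills := by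
  refine Summit.QuantumFields.YangMills.Cruxes.OSLegsAtWeakCouplingC.Y2Bridge.yangMills_of_legs ?_
  intro G _ _ _ _ hG
  letI : MeasurableSpace G := borel G
  haveI : BorelSpace G := ⟨rfl⟩
  have hu : ∀ β : ℝ, 0 < Summit.QuantumFields.YangMills.Cruxes.UVSeamRec.Transport.uRec β :=
    Summit.QuantumFields.YangMills.Cruxes.UVSeamRec.UnitTransfer.uRec_pos
  have hu0 : Tendsto Summit.QuantumFields.YangMills.Cruxes.UVSeamRec.Transport.uRec atTop (𝓝 0) :=
    Summit.QuantumFields.YangMills.Cruxes.UVSeamRec.UnitTransfer.tendsto_uRec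
  by_cases hcl : Nonempty (G ≃ₜ* Matrix.specialUnitaryGroup (Fin 2) ℂ)
  · obtain ⟨r, hlb, hmb⟩ := hSeamRec hUV G hG hcl
    exact ⟨r, _, hu, hu0, hmb, hlb, hIR G hG r _ hu hu0 hlb, hROT G hG r _ hu hu0 hlb hmb⟩
  · by_cases hex : ∃ N : ℕ, 2 ≤ N ∧ Nonempty (G ≃ₜ* Matrix.specialUnitaryGroup (Fin N) ℂ)
    · obtain ⟨N, hN2, ⟨e⟩⟩ := hex
      have hN3 : 3 ≤ N := by
        by_contra hlt
        obtain rfl : N = 2 := by omega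
        exact hcl ⟨e⟩
      haveI : NeZero N := ⟨by omega⟩
      obtain ⟨r, a, ha, ha0, hlb, hmb⟩ := legsWitness_of_continuousMulEquiv e (hWit N hN3 (hApexSUN N hN3))
      exact ⟨r, a, ha, ha0, hmb, hlb, hIR G hG r a ha ha0 hlb, hROT G hG r a ha ha0 hlb hmb⟩
    · obtain ⟨r, a, ha, ha0, hlb, hmb⟩ := hNonRec G hG (fun N hN => ⟨fun e => hex ⟨N, hN, ⟨e⟩⟩⟩)
      exact ⟨r, a, ha, ha0, hmb, hlb, hIR G hG r a ha ha0 hlb, hROT G hG r a ha ha0 hlb hmb⟩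

end Summit.QuantumFields.YangMills.Theorems.UVOtherGroups

end
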